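import Summits.QuantumFields.QCD.Theses.NestedDissectionSea
import Literature.Barriers.QuantumFields.WilsonDeterminantSign
import Literature.MathematicalPhysics.QuantumLattice.OverlapLocality
import Summits.QuantumFields.QCD.Theorems.NestedDissectionSeaSeaFactorisationBridgeStubFeshbachLocalisationAux

/-!
# Stub `stub_feshbachLocalisation` of line `proper-time-quarantine`
(crux `Summit.QuantumFields.QCD.Theses.NestedDissectionSea.SeaFactorisationBridge`, item stmt-QuantumFields-13880)

Feshbach–Combes–Thomas localisation of sub-threshold eigenvectors of `Γ₅ D_W` given coercivity
of a Dirichlet restriction (support form) — finite-dimensional linear algebra.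

Write `D = D_W(U, m) = (m + 4)·1 − K`, `K = Σ_μ W_μ` (`wilsonDirac_eq_sub_sum_wilsonHop`,
`‖K v‖₂ ≤ 4‖v‖₂`), `H = Γ₅ D`, `P = P_Ω` the site cut-off (`Set.indicator {p | Ω (site p)}`),
`E = diag(e^{ν φ(site)})` with `ν = log(1 + κ/32)`.  (1) Combes–Thomas: for a nonvanishing site
function `d`, `‖(diag d · W_μ − W_μ · diag d) u‖₂ ≤ 2M ‖diag d · u‖₂` whenever the nearest-neighbour
ratios satisfy `|d(x)/d(x ± μ̂) − 1| ≤ M` (the forward half `F ⊗ P⁻` couples `x` to `x + μ̂`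
only, the backward half `x + μ̂` to `x`); for `d = e^{ν φ}`, `φ` `1`-Lipschitz, `M = e^ν − 1`, so
`‖(E K − K E) u‖₂ ≤ 8(e^ν − 1)‖E u‖₂ = (κ/4)‖E u‖₂`.  (2) Feshbach: from `H w = λ w`,
`P(H − λ)P w = −P H (1 − P) w` is supported on the boundary layer `φ ≤ 1` and has norm `≤ 4‖w‖₂`,
while `‖P E (H − λ) P w‖₂ ≥ (κ − κ/2 − κ/4)‖E P w‖₂` by coercivity (`‖P D v‖₂ ≥ κ‖v‖₂` for `v`
supported in `Ω`), the `Γ₅`-isometry and (1); so `‖E P w‖₂ ≤ (16 e^ν/κ)‖w‖₂`.  (3) For `r ≥ 1`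
the level set `{φ ≥ r}` lies in `Ω` and `e^{2νr} Σ_{φ ≥ r} ‖w p‖² ≤ ‖E P w‖₂²`; `r = 0` is the
trivial bound `1 ≤ (32/κ + 1)²`.
-/

noncomputable section

namespace Summit.QuantumFields.QCD.Cruxes.SeaFactorisationBridge.ProperTimeQuarantine

open scoped BigOperators Topology Classical MeasureTheory Matrix ComplexConjugate ComplexOrder
open scoped Kronecker
open Filter MeasureTheory
open Literature.MathematicalPhysics.QuantumFieldTheory Literature.MathematicalPhysics.QuantumLattice
open Literature.Probability.LatticeModels
open Literature.MathematicalPhysics.QuantumLattice.NeubergerBound (eucNorm_sq_eq_sum)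
open Matrix

/-! ### The Combes–Thomas conjugation bound -/

section CombesThomas

variable {L Nc : ℕ} [NeZero L] {G : Type*} [Group G] (ρ : G →* Matrix (Fin Nc) (Fin Nc) ℂ)

/-- **Combes–Thomas bound for one hopping matrix**: for a nonvanishing site function `d` whose
nearest-neighbour ratios satisfy `‖d(x)/d(x+î) − 1‖, ‖d(x+î)/d(x) − 1‖ ≤ M`,
`‖(diag d · W_μ − W_μ · diag d) u‖₂ ≤ 2M ‖diag d · u‖₂`. [folklore] -/
theorem eucNorm_siteDiagonal_comm_wilsonHop_mulVec_le
    (hρ : ∀ g, ρ g ∈ Matrix.unitaryGroup (Fin Nc) ℂ) (U : GaugeConfig 4 L G)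
    {d : TorusSite 4 L → ℂ} (hd : ∀ x, d x ≠ 0) {M : ℝ} (hM : 0 ≤ M)
    (hMf : ∀ (x : TorusSite 4 L) (i : Fin 4), ‖d x * (d (Site.shift x i))⁻¹ - 1‖ ≤ M)
    (hMb : ∀ (x : TorusSite 4 L) (i : Fin 4), ‖d (Site.shift x i) * (d x)⁻¹ - 1‖ ≤ M)
    (i : Fin 4) (u : TorusSite 4 L × Fin Nc × Fin 4 → ℂ) :
    eucNorm ((diagonal (fun p : TorusSite 4 L × Fin Nc × Fin 4 => d p.1) * wilsonHop ρ U i -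
        wilsonHop ρ U i * diagonal (fun p : TorusSite 4 L × Fin Nc × Fin 4 => d p.1)) *ᵥ u) ≤
      2 * M * eucNorm (diagonal (fun p : TorusSite 4 L × Fin Nc × Fin 4 => d p.1) *ᵥ u) := by
  set E : Matrix (TorusSite 4 L × Fin Nc × Fin 4) (TorusSite 4 L × Fin Nc × Fin 4) ℂ :=
    diagonal (fun p : TorusSite 4 L × Fin Nc × Fin 4 => d p.1) with hE
  set A : Matrix (TorusSite 4 L × Fin Nc × Fin 4) (TorusSite 4 L × Fin Nc × Fin 4) ℂ :=
    Matrix.reindex (Equiv.prodAssoc _ _ _) (Equiv.prodAssoc _ _ _)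
      (linkHop ρ U i ⊗ₖ chiralProjMinus i) with hA
  set B : Matrix (TorusSite 4 L × Fin Nc × Fin 4) (TorusSite 4 L × Fin Nc × Fin 4) ℂ :=
    Matrix.reindex (Equiv.prodAssoc _ _ _) (Equiv.prodAssoc _ _ _)
      ((linkHop ρ U i)ᴴ ⊗ₖ chiralProjPlus i) with hB
  have hsplit : E * wilsonHop ρ U i - wilsonHop ρ U i * E = (E * A - A * E) + (E * B - B * E) := by
    rw [wilsonHop_eq_fwd_add_bwd, ← hA, ← hB, Matrix.mul_add, Matrix.add_mul]
    abel
  have hF : eucNorm ((E * A - A * E) *ᵥ u) ≤ M * eucNorm (E *ᵥ u) := by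
    rw [hE, hA, siteDiagonal_comm_hopFwd ρ hd U i, ← mulVec_mulVec, ← mulVec_mulVec]
    refine (eucNorm_diagonal_mulVec_le hM (fun p => ?_) _).trans
      (mul_le_mul_of_nonneg_left (eucNorm_hopFwd_mulVec_le ρ hρ U i _) hM)
    exact hMf p.1 i
  have hB' : eucNorm ((E * B - B * E) *ᵥ u) ≤ M * eucNorm (E *ᵥ u) := by
    rw [hE, hB, siteDiagonal_comm_hopBwd ρ hd U i, ← mulVec_mulVec, ← mulVec_mulVec]
    refine (eucNorm_hopBwd_mulVec_le ρ hρ U i _).trans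
      (eucNorm_diagonal_mulVec_le hM (fun q => ?_) _)
    exact hMb q.1 i
  rw [hsplit, add_mulVec]
  refine (eucNorm_add_le _ _).trans ?_
  linarith

/-- **Combes–Thomas bound for the hopping term**: `‖(diag d · K − K · diag d) u‖₂ ≤ 8M ‖diag d · u‖₂`,
`K = Σ_μ W_μ`. [folklore] -/
theorem eucNorm_siteDiagonal_comm_sum_wilsonHop_mulVec_le
    (hρ : ∀ g, ρ g ∈ Matrix.unitaryGroup (Fin Nc) ℂ) (U : GaugeConfig 4 L G)
    {d : TorusSite 4 L → ℂ} (hd : ∀ x, d x ≠ 0) {M : ℝ} (hM : 0 ≤ M)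
    (hMf : ∀ (x : TorusSite 4 L) (i : Fin 4), ‖d x * (d (Site.shift x i))⁻¹ - 1‖ ≤ M)
    (hMb : ∀ (x : TorusSite 4 L) (i : Fin 4), ‖d (Site.shift x i) * (d x)⁻¹ - 1‖ ≤ M)
    (u : TorusSite 4 L × Fin Nc × Fin 4 → ℂ) :
    eucNorm ((diagonal (fun p : TorusSite 4 L × Fin Nc × Fin 4 => d p.1) * (∑ i, wilsonHop ρ U i) -
        (∑ i, wilsonHop ρ U i) * diagonal (fun p : TorusSite 4 L × Fin Nc × Fin 4 => d p.1)) *ᵥ u) ≤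
      8 * M * eucNorm (diagonal (fun p : TorusSite 4 L × Fin Nc × Fin 4 => d p.1) *ᵥ u) := by
  set E : Matrix (TorusSite 4 L × Fin Nc × Fin 4) (TorusSite 4 L × Fin Nc × Fin 4) ℂ :=
    diagonal (fun p : TorusSite 4 L × Fin Nc × Fin 4 => d p.1) with hE
  have h : E * (∑ i, wilsonHop ρ U i) - (∑ i, wilsonHop ρ U i) * E =
      ∑ i, (E * wilsonHop ρ U i - wilsonHop ρ U i * E) := by
    rw [Finset.mul_sum, Finset.sum_mul, ← Finset.sum_sub_distrib]
  rw [h, sum_mulVec]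
  calc eucNorm (∑ i, (E * wilsonHop ρ U i - wilsonHop ρ U i * E) *ᵥ u)
      ≤ ∑ i, eucNorm ((E * wilsonHop ρ U i - wilsonHop ρ U i * E) *ᵥ u) := eucNorm_sum_le _ _
    _ ≤ ∑ _i : Fin 4, 2 * M * eucNorm (E *ᵥ u) := Finset.sum_le_sum fun i _ =>
        eucNorm_siteDiagonal_comm_wilsonHop_mulVec_le ρ hρ U hd hM hMf hMb i u
    _ = 8 * M * eucNorm (E *ᵥ u) := by
        simp only [Finset.sum_const, Finset.card_univ, Fintype.card_fin, nsmul_eq_mul]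
        push_cast
        ring

omit [NeZero L] in
/-- The exponential weight `e^{ν φ}` has nearest-neighbour ratio defects `≤ e^ν − 1` along any
step with `|φ(x) − φ(y)| ≤ 1` (`ν ≥ 0`). [folklore] -/
theorem norm_expWeight_defect_le {ν : ℝ} (hν : 0 ≤ ν) {a b : ℝ} (hab : |a - b| ≤ 1) :
    ‖((Real.exp (ν * a) : ℝ) : ℂ) * (((Real.exp (ν * b) : ℝ) : ℂ))⁻¹ - 1‖ ≤ Real.exp ν - 1 := by
  rw [← Complex.ofReal_inv, ← Complex.ofReal_mul, ← Complex.ofReal_one, ← Complex.ofReal_sub,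
    Complex.norm_real, Real.norm_eq_abs, ← Real.exp_neg, ← Real.exp_add,
    show ν * a + -(ν * b) = ν * (a - b) by ring]
  exact abs_exp_mul_sub_one_le hν hab

end CombesThomas

/-! ### The weighted Feshbach–Combes–Thomas bound -/

section Weighted

variable {L Nc : ℕ} [NeZero L] {G : Type*} [Group G] (ρ : G →* Matrix (Fin Nc) (Fin Nc) ℂ)

/-- **Weighted Feshbach–Combes–Thomas bound.**  Let `D = D_W(U, m)` (Wilson parameter `1`),
`H = Γ₅ D`, `Ω` a set of sites on which the Dirichlet restriction of `D` is `κ`-coercive in support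
form, `φ` a `1`-Lipschitz site weight vanishing off `Ω`, `E = e^{ν φ}` with `8(e^ν − 1) ≤ κ/4`, and
`H w = λ w` with `|λ| ≤ κ/2`.  Then `(κ/4)‖E P_Ω w‖₂ ≤ 4 e^ν ‖w‖₂`: the source
`P_Ω(H − λ)P_Ω w = −P_Ω H (1 − P_Ω) w` has size `≤ 4‖w‖₂` and lives where `φ ≤ 1`, while
`P_Ω E (H − λ) P_Ω` is bounded below by `κ − κ/2 − 8(e^ν − 1)` on `E P_Ω w` (coercivity,
`Γ₅`-isometry, Combes–Thomas). [folklore] -/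
theorem feshbach_weighted_bound (hρ : ∀ g, ρ g ∈ Matrix.unitaryGroup (Fin Nc) ℂ)
    (U : GaugeConfig 4 L G) (m : ℝ) (Ω : TorusSite 4 L → Prop) [DecidablePred Ω] {κ : ℝ}
    (hcoer : ∀ v : TorusSite 4 L × Fin Nc × Fin 4 → ℂ, (∀ p, ¬ Ω p.1 → v p = 0) →
      κ ^ 2 * ∑ p, ‖v p‖ ^ 2 ≤
        ∑ p ∈ Finset.univ.filter (fun p : TorusSite 4 L × Fin Nc × Fin 4 => Ω p.1),
          ‖(wilsonDirac ρ U m 1 *ᵥ v) p‖ ^ 2)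
    (hκ : 0 < κ) {ν : ℝ} (hν : 0 ≤ ν) (hνκ : 8 * (Real.exp ν - 1) ≤ κ / 4)
    {φ : TorusSite 4 L → ℝ} (hφ0 : ∀ y, ¬ Ω y → φ y = 0)
    (hφ1 : ∀ (x : TorusSite 4 L) (i : Fin 4), |φ (Site.shift x i) - φ x| ≤ 1)
    (w : TorusSite 4 L × Fin Nc × Fin 4 → ℂ) {lam : ℝ} (hlam : |lam| ≤ κ / 2)
    (heig : spinorLift gammaFive *ᵥ (wilsonDirac ρ U m 1 *ᵥ w) = (lam : ℂ) • w) :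
    κ / 4 * eucNorm (diagonal (fun p : TorusSite 4 L × Fin Nc × Fin 4 =>
        ((Real.exp (ν * φ p.1) : ℝ) : ℂ)) *ᵥ Set.indicator {q | Ω q.1} w) ≤
      4 * Real.exp ν * eucNorm w := by
  set E : Matrix (TorusSite 4 L × Fin Nc × Fin 4) (TorusSite 4 L × Fin Nc × Fin 4) ℂ :=
    diagonal (fun p : TorusSite 4 L × Fin Nc × Fin 4 => ((Real.exp (ν * φ p.1) : ℝ) : ℂ)) with hE
  set u := Set.indicator {q : TorusSite 4 L × Fin Nc × Fin 4 | Ω q.1} w with hu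
  set ut := E *ᵥ u with hut
  set X := (E * (∑ i, wilsonHop ρ U i) - (∑ i, wilsonHop ρ U i) * E) *ᵥ u with hX
  set T := Set.indicator {q : TorusSite 4 L × Fin Nc × Fin 4 | Ω q.1}
    (E *ᵥ (spinorLift gammaFive *ᵥ (wilsonDirac ρ U m 1 *ᵥ u) - (lam : ℂ) • u)) with hT
  have hDK := wilsonDirac_eq_sub_sum_wilsonHop ρ hρ U m
  have hu_supp : ∀ p, ¬ Ω p.1 → u p = 0 := fun p hp => siteCut_apply_of_not Ω hp
  have hu_mem : ∀ p, Ω p.1 → u p = w p := fun p hp => siteCut_apply_of_mem Ω hp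
  have hut_supp : ∀ p, ¬ Ω p.1 → ut p = 0 := fun p hp => by
    rw [hut, hE, mulVec_diagonal, hu_supp p hp, mul_zero]
  have hut_cut : Set.indicator {q : TorusSite 4 L × Fin Nc × Fin 4 | Ω q.1} ut = ut := by
    rw [hut, hE, siteCut_diagonal_mulVec, hu, siteCut_siteCut]
  -- the source `P_Ω(H − λ)P_Ω w` lives on the boundary layer `φ ≤ 1`
  have hφp : ∀ p, ((∑ i, wilsonHop ρ U i) *ᵥ (w - u)) p ≠ 0 → φ p.1 ≤ 1 := by
    intro p hp
    by_contra hcon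
    apply hp
    refine sum_wilsonHop_mulVec_apply_eq_zero ρ U (w - u) p fun q i hqi => ?_
    by_cases hq : Ω q.1
    · rw [Pi.sub_apply, hu_mem q hq, sub_self]
    · exfalso
      apply hcon
      have h0 := hφ0 q.1 hq
      rcases hqi with h | h
      · have h1 := hφ1 p.1 i
        rw [← h, h0, zero_sub, abs_neg] at h1
        exact (le_abs_self _).trans h1
      · have h1 := hφ1 q.1 i
        rw [← h, h0, sub_zero] at h1
        exact (le_abs_self _).trans h1
  -- upper bound on the weighted source
  have hupper : eucNorm T ≤ 4 * Real.exp ν * eucNorm w := by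
    have hpt : ∀ p, ‖T p‖ ≤ Real.exp ν * ‖((∑ i, wilsonHop ρ U i) *ᵥ (w - u)) p‖ := by
      intro p
      by_cases hp : Ω p.1
      · have e1 : spinorLift gammaFive *ᵥ (wilsonDirac ρ U m 1 *ᵥ u) =
            (lam : ℂ) • w - spinorLift gammaFive *ᵥ (wilsonDirac ρ U m 1 *ᵥ (w - u)) := by
          rw [mulVec_sub, mulVec_sub, heig]; abel
        have e2 : (wilsonDirac ρ U m 1 *ᵥ (w - u)) p =
            -(((∑ i, wilsonHop ρ U i) *ᵥ (w - u)) p) := by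
          have : (w - u) p = 0 := by rw [Pi.sub_apply, hu_mem p hp, sub_self]
          rw [hDK, sub_mulVec, smul_mulVec, one_mulVec, Pi.sub_apply, Pi.smul_apply, this,
            smul_zero, zero_sub]
        have e3 : T p = ((Real.exp (ν * φ p.1) : ℝ) : ℂ) *
            -((spinorLift gammaFive *ᵥ (wilsonDirac ρ U m 1 *ᵥ (w - u))) p) := by
          rw [hT, siteCut_apply_of_mem Ω hp, hE, mulVec_diagonal, Pi.sub_apply, Pi.smul_apply,
            smul_eq_mul, e1, Pi.sub_apply, Pi.smul_apply, smul_eq_mul, hu_mem p hp]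
          ring
        rw [e3, norm_mul, norm_neg, norm_spinorLift_gammaFive_mulVec_apply, e2, norm_neg,
          Complex.norm_real, Real.norm_eq_abs, abs_of_pos (Real.exp_pos _)]
        by_cases hK0 : ((∑ i, wilsonHop ρ U i) *ᵥ (w - u)) p = 0
        · rw [hK0, norm_zero, mul_zero, mul_zero]
        · have hle : ν * φ p.1 ≤ ν := by nlinarith [hφp p hK0]
          exact mul_le_mul_of_nonneg_right (Real.exp_le_exp.mpr hle) (norm_nonneg _)
      · rw [hT, siteCut_apply_of_not Ω hp, norm_zero]
        positivity
    calc eucNorm T ≤ Real.exp ν * eucNorm ((∑ i, wilsonHop ρ U i) *ᵥ (w - u)) :=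
          eucNorm_le_mul_of_pointwise (Real.exp_pos ν).le hpt
      _ ≤ Real.exp ν * (4 * eucNorm (w - u)) :=
          mul_le_mul_of_nonneg_left (eucNorm_sum_wilsonHop_mulVec_le ρ hρ U _) (Real.exp_pos ν).le
      _ ≤ Real.exp ν * (4 * eucNorm w) := by
          gcongr
          exact eucNorm_sub_siteCut_le Ω w
      _ = 4 * Real.exp ν * eucNorm w := by ring
  -- lower bound on the weighted source: the conjugated Feshbach operator
  have hED : E *ᵥ (wilsonDirac ρ U m 1 *ᵥ u) = wilsonDirac ρ U m 1 *ᵥ ut - X := by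
    rw [hX, hut, hDK]
    simp only [sub_mulVec, smul_mulVec, one_mulVec, mulVec_sub, mulVec_smul, ← mulVec_mulVec]
    abel
  have hTdec : T = spinorLift gammaFive *ᵥ Set.indicator {q | Ω q.1} (wilsonDirac ρ U m 1 *ᵥ ut) -
      spinorLift gammaFive *ᵥ Set.indicator {q | Ω q.1} X - (lam : ℂ) • ut := by
    rw [hT, mulVec_sub, mulVec_smul, ← hut, hE, ← spinorLift_gammaFive_mulVec_diagonal_mulVec,
      ← hE, hED, mulVec_sub, siteCut_sub, siteCut_sub, siteCut_smul, hut_cut,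
      siteCut_spinorLift_gammaFive_mulVec, siteCut_spinorLift_gammaFive_mulVec]
  have ha : κ * eucNorm ut ≤
      eucNorm (spinorLift gammaFive *ᵥ Set.indicator {q | Ω q.1} (wilsonDirac ρ U m 1 *ᵥ ut)) := by
    rw [eucNorm_spinorLift_gammaFive_mulVec]
    have h := hcoer ut hut_supp
    rw [← eucNorm_sq_eq_sum ut, ← eucNorm_siteCut_sq, ← mul_pow] at h
    exact (pow_le_pow_iff_left₀ (mul_nonneg hκ.le (eucNorm_nonneg _)) (eucNorm_nonneg _)
      two_ne_zero).mp h
  have hb : eucNorm (spinorLift gammaFive *ᵥ Set.indicator {q | Ω q.1} X) ≤ κ / 4 * eucNorm ut := by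
    rw [eucNorm_spinorLift_gammaFive_mulVec]
    refine (eucNorm_siteCut_le Ω X).trans ?_
    have hd : ∀ x : TorusSite 4 L, ((Real.exp (ν * φ x) : ℝ) : ℂ) ≠ 0 := fun x =>
      Complex.ofReal_ne_zero.mpr (Real.exp_pos _).ne'
    have hM : 0 ≤ Real.exp ν - 1 := by linarith [Real.add_one_le_exp ν]
    refine (eucNorm_siteDiagonal_comm_sum_wilsonHop_mulVec_le ρ hρ U hd hM
      (fun x i => norm_expWeight_defect_le hν (by rw [abs_sub_comm]; exact hφ1 x i))
      (fun x i => norm_expWeight_defect_le hν (hφ1 x i)) u).trans ?_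
    exact mul_le_mul_of_nonneg_right hνκ (eucNorm_nonneg _)
  have hc : eucNorm ((lam : ℂ) • ut) ≤ κ / 2 * eucNorm ut := by
    rw [eucNorm_smul, Complex.norm_real, Real.norm_eq_abs]
    exact mul_le_mul_of_nonneg_right hlam (eucNorm_nonneg _)
  have hlower : κ / 4 * eucNorm ut ≤ eucNorm T := by
    have e : spinorLift gammaFive *ᵥ Set.indicator {q | Ω q.1} (wilsonDirac ρ U m 1 *ᵥ ut) =
        T + spinorLift gammaFive *ᵥ Set.indicator {q | Ω q.1} X + (lam : ℂ) • ut := by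
      rw [hTdec]; abel
    have h1 := eucNorm_add_le (T + spinorLift gammaFive *ᵥ Set.indicator {q | Ω q.1} X)
      ((lam : ℂ) • ut)
    have h2 := eucNorm_add_le T (spinorLift gammaFive *ᵥ Set.indicator {q | Ω q.1} X)
    rw [← e] at h1
    linarith
  exact hlower.trans hupper

/-- **Level-set extraction**: for `r ≥ 1` the sites with `φ ≥ r` lie in `Ω` (as `φ = 0` off `Ω`),
and there `‖(E P_Ω w)(p)‖ = e^{ν φ} ‖w p‖ ≥ e^{ν r}‖w p‖`. [folklore] -/
theorem exp_sq_mul_levelSum_le (Ω : TorusSite 4 L → Prop) {ν : ℝ} (hν : 0 ≤ ν)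
    (φ : TorusSite 4 L → ℕ) (hφ0 : ∀ y, ¬ Ω y → φ y = 0)
    (w : TorusSite 4 L × Fin Nc × Fin 4 → ℂ) {r : ℕ} (hr : 0 < r) :
    Real.exp (ν * r) ^ 2 *
        ∑ p ∈ Finset.univ.filter (fun p : TorusSite 4 L × Fin Nc × Fin 4 => r ≤ φ p.1), ‖w p‖ ^ 2 ≤
      eucNorm (diagonal (fun p : TorusSite 4 L × Fin Nc × Fin 4 =>
        ((Real.exp (ν * (φ p.1 : ℝ)) : ℝ) : ℂ)) *ᵥ Set.indicator {q | Ω q.1} w) ^ 2 := by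
  rw [eucNorm_sq_eq_sum, Finset.mul_sum]
  refine (Finset.sum_le_sum fun p hp => ?_).trans
    (Finset.sum_le_univ_sum_of_nonneg fun p => by positivity)
  have hrp : r ≤ φ p.1 := (Finset.mem_filter.mp hp).2
  have hΩp : Ω p.1 := by
    by_contra hcon
    have := hφ0 p.1 hcon
    omega
  rw [mulVec_diagonal, siteCut_apply_of_mem Ω hΩp, norm_mul, Complex.norm_real,
    Real.norm_eq_abs, abs_of_pos (Real.exp_pos _), mul_pow]
  have hle : ν * r ≤ ν * (φ p.1 : ℝ) := mul_le_mul_of_nonneg_left (by exact_mod_cast hrp) hν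
  gcongr

end Weighted

/-! ### The registered stub -/

section Stub

/-- **Feshbach–Combes–Thomas localisation** (registered stub `stub_feshbachLocalisation`): a
sub-threshold eigenvector `Γ₅ D_W w = λ w`, `|λ| ≤ κ/2`, of the Hermitian Wilson operator is
exponentially small, in `ℓ²` over the level sets `{φ ≥ r}` of any anchored `1`-Lipschitz weight,
whenever the Dirichlet restriction of `D_W` to `Ω` is `κ`-coercive in support form; rate
`log(1 + κ/32)` per unit of `φ`, prefactor `(32/κ)²`. [folklore] -/
theorem stub_feshbachLocalisation :
    ∀ (N : ℕ) [NeZero N] (U : GaugeConfig 4 N (Matrix.specialUnitaryGroup (Fin 3) ℂ)) (μ : ℝ) (Ω : TorusSite 4 N → Prop) (κ : ℝ),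
      0 < κ →
      (∀ v : TorusSite 4 N × Fin 3 × Fin 4 → ℂ, (∀ p, ¬ Ω p.1 → v p = 0) →
          κ ^ 2 * ∑ p, ‖v p‖ ^ 2 ≤
            ∑ p ∈ Finset.univ.filter (fun p : TorusSite 4 N × Fin 3 × Fin 4 => Ω p.1),
              ‖(wilsonDirac (fundamentalRep (Fin 3)) U μ 1).mulVec v p‖ ^ 2) →
      ∀ φ : TorusSite 4 N → ℕ,
        ((∀ y, ¬ Ω y → φ y = 0) ∧
          ∀ (x : TorusSite 4 N) (i : Fin 4),
            φ (Site.shift x i) ≤ φ x + 1 ∧ φ x ≤ φ (Site.shift x i) + 1) →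
      ∀ (w : TorusSite 4 N × Fin 3 × Fin 4 → ℂ) (lam : ℝ), |lam| ≤ κ / 2 →
        (Literature.Barriers.QuantumFields.WilsonDeterminant.hermitianWilsonDirac
            (fundamentalRep (Fin 3)) U μ 1).mulVec w = (lam : ℂ) • w →
          ∀ r : ℕ,
            ∑ p ∈ Finset.univ.filter (fun p : TorusSite 4 N × Fin 3 × Fin 4 => r ≤ φ p.1), ‖w p‖ ^ 2 ≤
              (32 / κ) ^ 2 * Real.exp (-(2 * Real.log (1 + κ / 32) * ((r : ℝ) - 1))) *
                ∑ p, ‖w p‖ ^ 2 := by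
  intro N _ U μ Ω κ hκ hcoer φ hφ w lam hlam heig r
  obtain ⟨hφ0, hφ1⟩ := hφ
  have hρ : ∀ g, fundamentalRep (Fin 3) g ∈ Matrix.unitaryGroup (Fin 3) ℂ :=
    fundamentalRep_mem_unitaryGroup
  set ν := Real.log (1 + κ / 32) with hν
  have h32 : 0 < 1 + κ / 32 := by positivity
  have hexpν : Real.exp ν = 1 + κ / 32 := by rw [hν, Real.exp_log h32]
  have hν0 : 0 ≤ ν := by rw [hν]; exact Real.log_nonneg (by linarith)
  have hνκ : 8 * (Real.exp ν - 1) ≤ κ / 4 := by rw [hexpν]; linarith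
  have hφr0 : ∀ y, ¬ Ω y → (fun x => (φ x : ℝ)) y = 0 := fun y hy => by simp [hφ0 y hy]
  have hφr1 : ∀ (x : TorusSite 4 N) (i : Fin 4),
      |(fun x => (φ x : ℝ)) (Site.shift x i) - (fun x => (φ x : ℝ)) x| ≤ 1 := by
    intro x i
    obtain ⟨h1, h2⟩ := hφ1 x i
    have h1' : (φ (Site.shift x i) : ℝ) ≤ φ x + 1 := by exact_mod_cast h1
    have h2' : (φ x : ℝ) ≤ φ (Site.shift x i) + 1 := by exact_mod_cast h2
    rw [abs_sub_le_iff]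
    constructor <;> simp only <;> linarith
  have heig' : spinorLift gammaFive *ᵥ (wilsonDirac (fundamentalRep (Fin 3)) U μ 1 *ᵥ w) =
      (lam : ℂ) • w := by
    rw [mulVec_mulVec]; exact heig
  have hmain : κ / 4 * eucNorm (diagonal (fun p : TorusSite 4 N × Fin 3 × Fin 4 =>
      ((Real.exp (ν * (φ p.1 : ℝ)) : ℝ) : ℂ)) *ᵥ Set.indicator {q | Ω q.1} w) ≤
      4 * Real.exp ν * eucNorm w :=
    feshbach_weighted_bound (fundamentalRep (Fin 3)) hρ U μ Ω hcoer hκ hν0 hνκ hφr0 hφr1 w hlam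
      heig'
  have hut : eucNorm (diagonal (fun p : TorusSite 4 N × Fin 3 × Fin 4 =>
      ((Real.exp (ν * (φ p.1 : ℝ)) : ℝ) : ℂ)) *ᵥ Set.indicator {q | Ω q.1} w) ≤
      16 * Real.exp ν / κ * eucNorm w := by
    rw [div_mul_eq_mul_div, le_div_iff₀ hκ]
    linarith
  have hW : ∑ p, ‖w p‖ ^ 2 = eucNorm w ^ 2 := (eucNorm_sq_eq_sum w).symm
  have hS : 0 ≤ ∑ p, ‖w p‖ ^ 2 := Finset.sum_nonneg fun p _ => by positivity
  rcases Nat.eq_zero_or_pos r with hr | hr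
  · -- `r = 0`: the claim is `‖w‖² ≤ (32/κ + 1)² ‖w‖²`
    subst hr
    have hfilter : Finset.univ.filter (fun p : TorusSite 4 N × Fin 3 × Fin 4 => 0 ≤ φ p.1) =
        Finset.univ := Finset.filter_true_of_mem fun p _ => Nat.zero_le _
    rw [hfilter]
    have hc : 1 ≤ (32 / κ) ^ 2 * Real.exp (-(2 * ν * (((0 : ℕ) : ℝ) - 1))) := by
      have e : Real.exp (-(2 * ν * (((0 : ℕ) : ℝ) - 1))) = Real.exp ν ^ 2 := by
        rw [pow_two, ← Real.exp_add]
        congr 1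
        push_cast
        ring
      have hx : 32 / κ * (1 + κ / 32) = 32 / κ + 1 := by field_simp
      have hx1 : 1 ≤ 32 / κ * (1 + κ / 32) := by
        rw [hx]
        linarith [div_pos (by norm_num : (0 : ℝ) < 32) hκ]
      rw [e, ← mul_pow, hexpν]
      nlinarith
    calc ∑ p, ‖w p‖ ^ 2 = 1 * ∑ p, ‖w p‖ ^ 2 := (one_mul _).symm
      _ ≤ _ := mul_le_mul_of_nonneg_right hc hS
  · -- `r ≥ 1`: extract the level set from `‖E P_Ω w‖₂ ≤ (16 e^ν/κ)‖w‖₂`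
    have hkey := exp_sq_mul_levelSum_le (Nc := 3) Ω hν0 φ hφ0 w hr
    have hB : 0 < Real.exp (ν * r) ^ 2 := by positivity
    have hut2 : eucNorm (diagonal (fun p : TorusSite 4 N × Fin 3 × Fin 4 =>
        ((Real.exp (ν * (φ p.1 : ℝ)) : ℝ) : ℂ)) *ᵥ Set.indicator {q | Ω q.1} w) ^ 2 ≤
        (16 * Real.exp ν / κ * eucNorm w) ^ 2 := pow_le_pow_left₀ (eucNorm_nonneg _) hut 2
    have e : Real.exp (-(2 * ν * ((r : ℝ) - 1))) = Real.exp ν ^ 2 / Real.exp (ν * r) ^ 2 := by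
      rw [pow_two, pow_two, ← Real.exp_add, ← Real.exp_add, ← Real.exp_sub]
      congr 1
      ring
    rw [e, hW, show (32 / κ) ^ 2 * (Real.exp ν ^ 2 / Real.exp (ν * r) ^ 2) * eucNorm w ^ 2 =
        4 * (16 * Real.exp ν / κ * eucNorm w) ^ 2 / Real.exp (ν * r) ^ 2 by ring,
      le_div_iff₀ hB]
    nlinarith [hkey, hut2]

end Stub

end Summit.QuantumFields.QCD.Cruxes.SeaFactorisationBridge.ProperTimeQuarantine

end
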